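import Summits.MatrixMultiplication.MatrixMultiplication.Theorems.SoloBlindWindowThreeLemmas
import Summits.MatrixMultiplication.MatrixMultiplication.Theorems.SoloBlindHThreeSets

/-!
# H(3) = 4 for sequences, part 1: twin members are alone; transfer to the value set (solo-blind, s80)

Setting of `SoloBlindWindowTwo`: `h : ι → G` (`G` abelian of exponent `3`) zero-sum free on `S`, `τ` H-GOOD
(no sub-sum over `S` equals `τ + τ`).  Towards H(3) = 4 (`N_3(τ) ≤ 4` in all ranks) this file proves:

* `soloBlind_twin_member_alone` — if a cubic representation `D = {x, x', k}` of `τ` contains a twin pair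
  (`h x = h x'`), it is the ONLY cubic representation: `k` has no twin (`{k,k₂,x}` would have sum `τ+τ`); a member
  through exactly one twin `{x,p,q}` makes `{k,p,q}` sum to `τ+τ`; a member avoiding both twins passes through `k`
  and `{s,t,x}` is a zero-sum.  Hence `soloBlind_seqRep_three_card_eq_one_of_twin_member`.
* `soloBlind_exists_section`, `soloBlind_image_zsf_set`, `soloBlind_image_hgood_set` — the value set
  `S.image h` is a zero-sum-free `H`-good SET (in the conventions of `SoloBlindHThreeSets`), so the squarefree
  theorems apply to the value triples; `soloBlind_image_mem_rep3` — a distinct-valued cubic representation maps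
  to a member of `soloBlindRep3 (S.image h) τ`.
-/

namespace Summit.MatrixMultiplication.MatrixMultiplication.Theorems

open Finset

variable {ι G : Type*} [DecidableEq ι] [AddCommGroup G] [DecidableEq G]

omit [AddCommGroup G] [DecidableEq G] in
/-- The third element of a `3`-set containing `x ≠ x'`. -/
theorem soloBlind_triple_third {M : Finset ι} (hMc : M.card = 3) {x x' : ι} (hxM : x ∈ M) (hx'M : x' ∈ M)
    (hxx' : x ≠ x') : ∃ k, k ∈ M ∧ k ≠ x ∧ k ≠ x' ∧ M = insert x (insert x' {k}) := by
  have hx'Mx : x' ∈ M.erase x := Finset.mem_erase.mpr ⟨fun e => hxx' e.symm, hx'M⟩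
  have hKc : ((M.erase x).erase x').card = 1 := by
    rw [Finset.card_erase_of_mem hx'Mx, Finset.card_erase_of_mem hxM, hMc]
  obtain ⟨k, hK⟩ := Finset.card_eq_one.mp hKc
  have hk : k ∈ (M.erase x).erase x' := by rw [hK]; exact Finset.mem_singleton_self k
  have hk1 := Finset.mem_erase.mp hk
  have hk2 := Finset.mem_erase.mp hk1.2
  refine ⟨k, hk2.2, hk2.1, hk1.1, ?_⟩
  rw [← hK, Finset.insert_erase hx'Mx, Finset.insert_erase hxM]

omit [DecidableEq G] in
/-- Sum over a triple written with `insert`. -/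
theorem soloBlind_sum_triple {x x' k : ι} (hxx' : x ≠ x') (hxk : x ≠ k) (hx'k : x' ≠ k) (f : ι → G) :
    ∑ i ∈ insert x (insert x' ({k} : Finset ι)), f i = f x + (f x' + f k) := by
  have h1 : x ∉ insert x' ({k} : Finset ι) := by
    simp only [Finset.mem_insert, Finset.mem_singleton, not_or]; exact ⟨hxx', hxk⟩
  have h2 : x' ∉ ({k} : Finset ι) := by
    simp only [Finset.mem_singleton]; exact hx'k
  rw [Finset.sum_insert h1, Finset.sum_insert h2, Finset.sum_singleton]

/-- Auxiliary: with a twin member `D ∋ x, x'`, no member passes through `x` avoiding `x'`. -/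
theorem soloBlind_twin_member_aux (three : ∀ g : G, g + g + g = 0) {h : ι → G} {S : Finset ι}
    (zsf : ∀ T ⊆ S, T.Nonempty → ∑ i ∈ T, h i ≠ 0) {τ : G}
    (hgood : ∀ T ⊆ S, ∑ i ∈ T, h i ≠ τ + τ) {D : Finset ι} (hD : D ∈ soloBlindSeqRep h S 3 τ)
    {x x' : ι} (hxD : x ∈ D) (hx'D : x' ∈ D) (hxx' : x ≠ x') (htwin : h x' = h x)
    {M : Finset ι} (hM : M ∈ soloBlindSeqRep h S 3 τ) (hxM : x ∈ M) (hx'M : x' ∉ M) : False := by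
  obtain ⟨hDS, hDc, hDsum⟩ := soloBlind_mem_seqRep.mp hD
  obtain ⟨hMS, hMc, hMsum⟩ := soloBlind_mem_seqRep.mp hM
  obtain ⟨k, hkD, hkx, hkx', hDeq⟩ := soloBlind_triple_third hDc hxD hx'D hxx'
  have eD : h x + (h x + h k) = τ := by
    rw [hDeq, soloBlind_sum_triple hxx' hkx.symm hkx'.symm, htwin] at hDsum; exact hDsum
  have e := Finset.add_sum_erase M h hxM
  rw [hMsum] at e
  by_cases hkQ : k ∈ M.erase x
  · have hKc : ((M.erase x).erase k).card = 1 := by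
      rw [Finset.card_erase_of_mem hkQ, Finset.card_erase_of_mem hxM, hMc]
    obtain ⟨q, hK⟩ := Finset.card_eq_one.mp hKc
    have e2 := Finset.add_sum_erase (M.erase x) h hkQ
    rw [hK, Finset.sum_singleton] at e2
    rw [← e2] at e
    -- e : h x + (h k + h q) = τ
    have hq : h q = h x := by
      rw [← eD] at e
      have e3 := add_left_cancel e
      rw [add_comm (h x) (h k)] at e3
      exact add_left_cancel e3
    have hqQ : q ∈ (M.erase x).erase k := by rw [hK]; exact Finset.mem_singleton_self q
    have hq1 := Finset.mem_erase.mp hqQ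
    have hq2 := Finset.mem_erase.mp hq1.2
    have hqx' : q ≠ x' := fun e' => hx'M (e' ▸ hq2.2)
    have hZ : ∑ i ∈ insert x (insert x' ({q} : Finset ι)), h i = 0 := by
      rw [soloBlind_sum_triple hxx' (fun e' => hq2.1 e'.symm) (fun e' => hqx' e'.symm), htwin, hq,
        ← add_assoc]
      exact three (h x)
    refine zsf _ ?_ ⟨x, Finset.mem_insert_self _ _⟩ hZ
    exact Finset.insert_subset (hDS hxD)
      (Finset.insert_subset (hDS hx'D) (Finset.singleton_subset_iff.mpr (hMS hq2.2)))
  · have hZ : ∑ i ∈ insert k (M.erase x), h i = τ + τ := by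
      rw [Finset.sum_insert hkQ]
      have e3 : h k + ∑ i ∈ M.erase x, h i =
          (h x + (h x + h k)) + (h x + ∑ i ∈ M.erase x, h i) - (h x + h x + h x) := by abel
      rw [e3, eD, e, three (h x), sub_zero]
    exact hgood _ (Finset.insert_subset (hDS hkD) ((Finset.erase_subset _ _).trans hMS)) hZ

/-- TWIN MEMBERS ARE ALONE: a cubic representation of `τ` containing a twin pair is the only cubic
representation of `τ`. -/
theorem soloBlind_twin_member_alone (three : ∀ g : G, g + g + g = 0) {h : ι → G} {S : Finset ι}
    (zsf : ∀ T ⊆ S, T.Nonempty → ∑ i ∈ T, h i ≠ 0) {τ : G}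
    (hgood : ∀ T ⊆ S, ∑ i ∈ T, h i ≠ τ + τ) {D : Finset ι} (hD : D ∈ soloBlindSeqRep h S 3 τ)
    {x x' : ι} (hxD : x ∈ D) (hx'D : x' ∈ D) (hxx' : x ≠ x') (htwin : h x' = h x)
    {M : Finset ι} (hM : M ∈ soloBlindSeqRep h S 3 τ) : M = D := by
  obtain ⟨hDS, hDc, hDsum⟩ := soloBlind_mem_seqRep.mp hD
  obtain ⟨hMS, hMc, hMsum⟩ := soloBlind_mem_seqRep.mp hM
  obtain ⟨k, hkD, hkx, hkx', hDeq⟩ := soloBlind_triple_third hDc hxD hx'D hxx'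
  have eD : h x + (h x + h k) = τ := by
    have hs := hDsum
    rw [hDeq, soloBlind_sum_triple hxx' hkx.symm hkx'.symm, htwin] at hs; exact hs
  by_cases hxM : x ∈ M
  · by_cases hx'M : x' ∈ M
    · obtain ⟨k₂, hk₂M, hk₂x, hk₂x', hMeq⟩ := soloBlind_triple_third hMc hxM hx'M hxx'
      have eM : h x + (h x + h k₂) = τ := by
        have hs := hMsum
        rw [hMeq, soloBlind_sum_triple hxx' hk₂x.symm hk₂x'.symm, htwin] at hs; exact hs
      by_cases hkk : k₂ = k
      · rw [hMeq, hDeq, hkk]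
      · exfalso
        have hkk₂v : h k₂ = h k := by
          rw [← eD] at eM
          exact add_left_cancel (add_left_cancel eM)
        have hZ : ∑ i ∈ insert k (insert k₂ ({x} : Finset ι)), h i = τ + τ := by
          rw [soloBlind_sum_triple (fun e => hkk e.symm) hkx hk₂x, hkk₂v]
          have e3 : h k + (h k + h x) =
              (h x + (h x + h k)) + (h x + (h x + h k)) - (h x + h x + h x) := by abel
          rw [e3, eD, three (h x), sub_zero]
        exact hgood _ (Finset.insert_subset (hDS hkD) (Finset.insert_subset (hMS hk₂M)
          (Finset.singleton_subset_iff.mpr (hDS hxD)))) hZ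
    · exact (soloBlind_twin_member_aux three zsf hgood hD hxD hx'D hxx' htwin hM hxM hx'M).elim
  · by_cases hx'M : x' ∈ M
    · exact (soloBlind_twin_member_aux three zsf hgood hD hx'D hxD hxx'.symm htwin.symm hM hx'M hxM).elim
    · exfalso
      have hkM : k ∈ M := by
        by_contra hkM
        refine soloBlind_hgood_not_disjoint hgood hM hD (Finset.disjoint_right.mpr ?_)
        intro w hw
        rw [hDeq] at hw
        simp only [Finset.mem_insert, Finset.mem_singleton] at hw
        rcases hw with hw | hw | hw
        · rw [hw]; exact hxM
        · rw [hw]; exact hx'M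
        · rw [hw]; exact hkM
      have e := Finset.add_sum_erase M h hkM
      rw [hMsum] at e
      have hxQ : x ∉ M.erase k := fun hx => hxM (Finset.mem_of_mem_erase hx)
      have hZ : ∑ i ∈ insert x (M.erase k), h i = 0 := by
        rw [Finset.sum_insert hxQ]
        have e3 : h x + ∑ i ∈ M.erase k, h i =
            (h k + ∑ i ∈ M.erase k, h i) + (h x + h x + h x) - (h x + (h x + h k)) := by abel
        rw [e3, e, eD, three (h x), add_zero, sub_self]
      exact zsf _ (Finset.insert_subset (hDS hxD) ((Finset.erase_subset _ _).trans hMS))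
        ⟨x, Finset.mem_insert_self _ _⟩ hZ

/-- Consequently, if some cubic representation of `τ` contains a twin pair then `N_3(τ) = 1`. -/
theorem soloBlind_seqRep_three_card_eq_one_of_twin_member (three : ∀ g : G, g + g + g = 0) {h : ι → G}
    {S : Finset ι} (zsf : ∀ T ⊆ S, T.Nonempty → ∑ i ∈ T, h i ≠ 0) {τ : G}
    (hgood : ∀ T ⊆ S, ∑ i ∈ T, h i ≠ τ + τ) {D : Finset ι} (hD : D ∈ soloBlindSeqRep h S 3 τ)
    {x x' : ι} (hxD : x ∈ D) (hx'D : x' ∈ D) (hxx' : x ≠ x') (htwin : h x' = h x) :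
    (soloBlindSeqRep h S 3 τ).card = 1 := by
  rw [Finset.card_eq_one]
  refine ⟨D, Finset.eq_singleton_iff_unique_mem.mpr ⟨hD, fun M hM => ?_⟩⟩
  exact soloBlind_twin_member_alone three zsf hgood hD hxD hx'D hxx' htwin hM

omit [DecidableEq ι] in
/-- A cubic representation whose three values are not pairwise distinct contains a twin pair. -/
theorem soloBlind_exists_twin_of_card_image_lt {h : ι → G} {S : Finset ι} {τ : G} {M : Finset ι}
    (hM : M ∈ soloBlindSeqRep h S 3 τ) (hlt : (M.image h).card < 3) :
    ∃ x ∈ M, ∃ x' ∈ M, x ≠ x' ∧ h x = h x' := by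
  obtain ⟨-, hMc, -⟩ := soloBlind_mem_seqRep.mp hM
  exact Finset.exists_ne_map_eq_of_card_lt_of_maps_to (by rw [hMc]; exact hlt)
    (fun a ha => Finset.mem_image_of_mem h ha)

/-! ### Transfer to the value set `S.image h` -/

omit [DecidableEq ι] in
/-- Every subset of the value set has an index section with the same sum. -/
theorem soloBlind_exists_section (h : ι → G) (S : Finset ι) :
    ∀ T' : Finset G, T' ⊆ S.image h → ∃ T : Finset ι, T ⊆ S ∧ T.image h = T' ∧ ∑ i ∈ T, h i = ∑ x ∈ T', x := by
  classical
  intro T'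
  refine Finset.induction_on T' ?_ ?_
  · intro _
    exact ⟨∅, Finset.empty_subset _, Finset.image_empty _, by simp⟩
  · intro a T' haT' ih hsub
    obtain ⟨T, hTS, hTim, hTsum⟩ := ih ((Finset.subset_insert a T').trans hsub)
    obtain ⟨i, hiS, hia⟩ := Finset.mem_image.mp (hsub (Finset.mem_insert_self a T'))
    have hiT : i ∉ T := by
      intro hiT
      apply haT'
      rw [← hTim, ← hia]
      exact Finset.mem_image_of_mem h hiT
    refine ⟨insert i T, Finset.insert_subset hiS hTS, by rw [Finset.image_insert, hia, hTim], ?_⟩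
    rw [Finset.sum_insert hiT, Finset.sum_insert haT', hia, hTsum]

omit [DecidableEq ι] in
/-- The value set of a zero-sum-free sequence is a zero-sum-free set. -/
theorem soloBlind_image_zsf_set {h : ι → G} {S : Finset ι}
    (zsf : ∀ T ⊆ S, T.Nonempty → ∑ i ∈ T, h i ≠ 0) :
    ∀ T' ⊆ S.image h, ∑ x ∈ T', x = 0 → T' = ∅ := by
  classical
  intro T' hT' hsum
  obtain ⟨T, hTS, hTim, hTsum⟩ := soloBlind_exists_section h S T' hT'
  by_contra hne
  have hTne : T.Nonempty := by
    rw [Finset.nonempty_iff_ne_empty]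
    intro hT
    apply hne
    rw [← hTim, hT, Finset.image_empty]
  exact zsf T hTS hTne (by rw [hTsum, hsum])

omit [DecidableEq ι] in
/-- The value set of an `H`-good sequence is `H`-good in the convention of `SoloBlindHThreeSets` (`≠ -τ`). -/
theorem soloBlind_image_hgood_set (three : ∀ g : G, g + g + g = 0) {h : ι → G} {S : Finset ι} {τ : G}
    (hgood : ∀ T ⊆ S, ∑ i ∈ T, h i ≠ τ + τ) :
    ∀ T' ⊆ S.image h, ∑ x ∈ T', x ≠ -τ := by
  classical
  intro T' hT' hsum
  obtain ⟨T, hTS, hTim, hTsum⟩ := soloBlind_exists_section h S T' hT'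
  refine hgood T hTS ?_
  rw [hTsum, hsum]
  exact (eq_neg_of_add_eq_zero_left (three τ)).symm

omit [DecidableEq ι] in
/-- A distinct-valued cubic representation of `τ` maps to a 3-subset of the value set with sum `τ`. -/
theorem soloBlind_image_mem_rep3 {h : ι → G} {S : Finset ι} {τ : G} {M : Finset ι}
    (hM : M ∈ soloBlindSeqRep h S 3 τ) (hc : (M.image h).card = 3) :
    M.image h ∈ soloBlindRep3 (S.image h) τ := by
  obtain ⟨hMS, hMc, hMsum⟩ := soloBlind_mem_seqRep.mp hM
  rw [soloBlind_mem_rep3]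
  refine ⟨Finset.image_subset_image hMS, hc, ?_⟩
  have hinj : Set.InjOn h M := Finset.injOn_of_card_image_eq (by rw [hc, hMc])
  rw [Finset.sum_image (fun x hx y hy hxy => hinj hx hy hxy)]
  exact hMsum

omit [DecidableEq ι] in
/-- In a distinct-valued cubic representation two indices with the same value coincide. -/
theorem soloBlind_eq_of_value_eq {h : ι → G} {S : Finset ι} {τ : G} {M : Finset ι}
    (hM : M ∈ soloBlindSeqRep h S 3 τ) (hc : (M.image h).card = 3) {i j : ι} (hi : i ∈ M) (hj : j ∈ M)
    (hij : h i = h j) : i = j := by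
  obtain ⟨-, hMc, -⟩ := soloBlind_mem_seqRep.mp hM
  have hinj : Set.InjOn h M := Finset.injOn_of_card_image_eq (by rw [hc, hMc])
  exact hinj hi hj hij

omit [DecidableEq ι] in
/-- The number of value triples is at most three (squarefree H(3) on the value set). -/
theorem soloBlind_valueTriples_card_le_three (three : ∀ g : G, g + g + g = 0) {h : ι → G} {S : Finset ι}
    (zsf : ∀ T ⊆ S, T.Nonempty → ∑ i ∈ T, h i ≠ 0) {τ : G}
    (hgood : ∀ T ⊆ S, ∑ i ∈ T, h i ≠ τ + τ)
    (hdist : ∀ M ∈ soloBlindSeqRep h S 3 τ, (M.image h).card = 3) :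
    ((soloBlindSeqRep h S 3 τ).image (fun M => M.image h)).card ≤ 3 := by
  have hsub : (soloBlindSeqRep h S 3 τ).image (fun M => M.image h) ⊆ soloBlindRep3 (S.image h) τ := by
    intro V hV
    obtain ⟨M, hM, rfl⟩ := Finset.mem_image.mp hV
    exact soloBlind_image_mem_rep3 hM (hdist M hM)
  exact (Finset.card_le_card hsub).trans
    (soloBlind_rep3_card_le_three_of_hgood (soloBlind_image_zsf_set zsf) three
      (soloBlind_image_hgood_set three hgood))

end Summit.MatrixMultiplication.MatrixMultiplication.Theorems
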